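import Literature.Topology.FourManifolds.SlideContext
import Literature.AlgebraicTopology.FundamentalGroup.FlowTracks
import Literature.AlgebraicTopology.FundamentalGroup.IsotopyTrack
import HarnessLib

/-!
# Pushing loops below the seed collar of a slide context

Topic `Literature/Topology/FourManifolds` (fact seat
`provefact-Literature.Topology.FourManifolds.lauden-f709dd520c`, Laudenbach–Poénaru's Lemma 2).
Everything here is **proved**; no named facts.

For a slide context `C` (`SlideContext.lean`) the sublevel set `{f ≤ a}` below the feet of the
handle contains no critical point above the level `ℓ₁ = c - 4τ`, and the unit-speed flow pushes
it down: **every loop of `{f ≤ a}` based at a point `x₀` with `f x₀ ≤ c - 2τ` is homotopic, rel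
base point, to a loop of `{f ≤ c - 2τ}`** (`SlideContext.exists_loop_below`; the push-down
homotopy `FlowTrack.pushDownHomotopy` of `FlowTracks.lean` has constant track at `x₀`, and the
track formula `IsotopyTrack.mapOfEq_mk_map_loop` applies).  Consequently the classes of such
loops lie in the image of `π₁({f ≤ c - 2τ}, x₀)`, the subgroup on which the slide and flip
diffeomorphisms (the identity below `c - 2τ`) act trivially.

## References

* J. Milnor, *Lectures on the h-cobordism theorem* (1965), Thm. 3.4 (PDF p. 13).
  [MilnorHCobordism1965]
* A. Hatcher, *Algebraic Topology* (2002), Lemma 1.19. [HatcherAT2002]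
* F. Laudenbach, V. Poénaru, Bull. Soc. Math. France 100 (1972), proof of Lemma 2 (p. 340).
  [LaudenbachPoenaruBSMF1972]
-/

open scoped Manifold ContDiff Topology unitInterval
open Set Function Metric

noncomputable section

namespace Literature.Topology.FourManifolds

open Literature.AlgebraicTopology.FundamentalGroup

universe u

namespace SlideContext

variable {n : ℕ} {M : Type u} [TopologicalSpace M] [ChartedSpace (EuclideanHalfSpace (n + 1)) M]
  [IsManifold (𝓡∂ (n + 1)) ∞ M] (C : SlideContext n M)

/-- The clock of the unit-speed slab `f⁻¹(ℓ₁, a + 2η)`: `f (θ (t, x)) = f x + t` while both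
levels lie in the slab. [cite: MilnorHCobordism1965, proof of Thm. 3.4 (PDF p. 13)] -/
theorem clock : ∀ x t, C.S.f x ∈ Ioo C.S.ℓ₁ (C.S.a + 2 * C.S.η) → C.S.f x + t ∈ Ioo C.S.ℓ₁ (C.S.a + 2 * C.S.η) →
    C.S.f (C.S.θ (t, x)) = C.S.f x + t := fun x t hx ht => C.toCtx.Sl.apply_flow (x := x) hx (t := t) ht

/-- **Loops below the feet are homotopic to loops below the seed collar.**  For `x₀` with
`f x₀ ≤ c - 2τ` and a loop `γ` at `x₀` inside `{f ≤ a}`, the pushed-down loop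
`Π₁ ∘ γ` lies in `{f ≤ c - 2τ}` and is homotopic to `γ` rel `x₀`. [cite: MilnorHCobordism1965, Thm. 3.4 (PDF p. 13)]
[cite: HatcherAT2002, Lemma 1.19] -/
theorem exists_loop_below {x₀ : M} (hx₀ : C.S.f x₀ ≤ C.c - 2 * C.τ) (γ : Path x₀ x₀)
    (hγ : ∀ s, C.S.f (γ s) ≤ C.S.a) :
    ∃ γ' : Path x₀ x₀, (∀ s, C.S.f (γ' s) ≤ C.c - 2 * C.τ) ∧
      Path.Homotopic.Quotient.mk γ' = Path.Homotopic.Quotient.mk γ := by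
  have hθ : Continuous C.S.θ := C.S.flow.contMDiff.continuous
  have h0 : ∀ x, C.S.θ (0, x) = x := C.S.isFlowOf.map_zero
  set f : C(M, ℝ) := ⟨C.S.f, C.S.hf.continuous⟩ with hf
  set ℓ : ℝ := C.c - 2 * C.τ with hℓ
  have hτ := C.τ_pos; have hη := C.S.η_pos
  have hc_le : C.c + 8 * C.τ ≤ C.S.a - 24 * C.S.ε ^ 2 := by
    have := C.toCtx.c_le; simpa only [toCtx_c, toCtx_τ, toCtx_S] using this
  have hlo : C.S.ℓ₁ < ℓ := by rw [hℓ, C.hℓ₁_eq]; linarith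
  -- the push-down map and its homotopy from the identity, with constant track at `x₀`
  set G : C(M, M) := FlowTrack.pushDown hθ f ℓ 1 with hG
  set F := FlowTrack.pushDownHomotopy hθ h0 f ℓ with hF
  have hx₀ℓ : f x₀ ≤ ℓ := hx₀
  have hGx₀ : G x₀ = x₀ := FlowTrack.pushDown_apply_of_le hθ h0 f ℓ 1 hx₀ℓ
  have hfix : ∀ t, F (t, x₀) = (ContinuousMap.id M) x₀ := fun t => by
    rw [hF, FlowTrack.pushDownHomotopy_apply, FlowTrack.dropTime_eq_zero_of_le f ℓ hx₀ℓ, mul_zero, neg_zero, h0]; rfl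
  have hGz : G ((ContinuousMap.id M) x₀) = (ContinuousMap.id M) x₀ := hGx₀
  have key := IsotopyTrack.mapOfEq_mk_map_loop (ContinuousMap.id M) G
    (F : ContinuousMap.Homotopy (ContinuousMap.id M) (G.comp (ContinuousMap.id M))) hfix hGz γ
  rw [FundamentalGroup.mapOfEq_apply] at key
  change (Path.Homotopic.Quotient.map (Path.Homotopic.Quotient.mk (γ.map (map_continuous (ContinuousMap.id M)))) G).cast
      hGz.symm hGz.symm = Path.Homotopic.Quotient.mk (γ.map (map_continuous (ContinuousMap.id M))) at key
  rw [← Path.Homotopic.Quotient.mk_map, ← Path.Homotopic.Quotient.mk_cast] at key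
  have hid : γ.map (map_continuous (ContinuousMap.id M)) = γ := by ext t; rfl
  rw [hid] at key
  refine ⟨(γ.map (map_continuous G)).cast hGz.symm hGz.symm, fun s => ?_, key⟩
  -- the pushed-down loop lies below `c - 2τ`
  show C.S.f (G (γ s)) ≤ ℓ
  exact FlowTrack.apply_pushDown_one_le hθ h0 (f := f) C.clock hlo (by show C.S.f (γ s) < C.S.a + 2 * C.S.η; linarith [hγ s])

/-- **The class of a loop below the feet lies in the image of `π₁({f ≤ c - 2τ})`.**  Phrased
with sets of classes: the class of `γ` is the class of a loop inside `{f ≤ c - 2τ}`.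
[cite: MilnorHCobordism1965, Thm. 3.4 (PDF p. 13)] [cite: HatcherAT2002, Lemma 1.19] -/
theorem fromPath_mem_of_le {x₀ : M} (hx₀ : C.S.f x₀ ≤ C.c - 2 * C.τ) (γ : Path x₀ x₀)
    (hγ : ∀ s, C.S.f (γ s) ≤ C.S.a) :
    FundamentalGroup.fromPath (Path.Homotopic.Quotient.mk γ) ∈
      {w : FundamentalGroup M x₀ | ∃ γ' : Path x₀ x₀, (∀ s, C.S.f (γ' s) ≤ C.c - 2 * C.τ) ∧
        FundamentalGroup.fromPath (Path.Homotopic.Quotient.mk γ') = w} := by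
  obtain ⟨γ', hγ', h⟩ := C.exists_loop_below hx₀ γ hγ
  exact ⟨γ', hγ', by rw [h]⟩

end SlideContext

end Literature.Topology.FourManifolds
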